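import Literature.NumberTheory.Transcendental.MZVSimplexRep
import HarnessLib

/-!
# Brown's theorem: the periods of the moduli spaces `𝔐_{0,n}` are multiple zeta values

The named fact `Literature.NumberTheory.Transcendental.GenusZeroPeriodsMZV`: the theorem of
F. Brown (predicted by Goncharov–Manin) that every absolutely convergent integral, over a cell of
`𝔐_{0,n}(ℝ)`, of a regular algebraic top form on `𝔐_{0,n}` defined over `ℚ` is a `ℚ`-linear
combination of multiple zeta values of weight at most `ℓ = n - 3 = dim 𝔐_{0,n}`
[Brown, *Multiple zeta values and periods of moduli spaces `𝔐̄_{0,n}`*, Ann. Sci. ÉNS 42 (2009),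
Thm 1.1; for real cells: Lemma 7.4, Thm 8.2, Cor 8.3].

## The statement recorded here (real, single-cell form in simplicial coordinates)

In simplicial coordinates [Brown 2009, §2.1]
`𝔐_{0,ℓ+3} ≅ {(t₀, …, t_{ℓ-1}) ∈ 𝔸^ℓ | tᵢ ∉ {0, 1}, tᵢ ≠ tⱼ}`, the complement of the braid
arrangement, whose ring of regular functions over `ℚ` is `ℚ[tᵢ, tᵢ⁻¹, (1 - tᵢ)⁻¹, (tᵢ - tⱼ)⁻¹]`;
so a regular `ℓ`-form defined over `ℚ` is `f dt₀ ∧ ⋯ ∧ dt_{ℓ-1}` with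
`f = P(t) / (∏ᵢ tᵢ^{bᵢ} · ∏ᵢ (1 - tᵢ)^{cᵢ} · ∏_{i<j} (tᵢ - tⱼ)^{aᵢⱼ})`, `P ∈ ℚ[t]`, `a, b, c ≥ 0`.
The standard cell `X_{S,δ}` is the open ordered simplex, written here as
`KZ.openOrderedSimplex ℓ = {1 > t₀ > t₁ > ⋯ > t_{ℓ-1} > 0}` (Brown orders the coordinates
increasingly; relabelling `i ↦ ℓ - 1 - i` identifies the two, and the class of integrands is
stable).
Absolute convergence is `MeasureTheory.IntegrableOn` for Lebesgue measure, exactly the datum bundled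
in `KZ.IntegralRep`. The conclusion "`ℚ`-linear combination of multiple zeta values of weight at
most `ℓ`" is membership in `⨆_{w ≤ ℓ} mzvSpace w`, where `mzvSpace w` is the `ℚ`-span of the
`multipleZeta s`, `s` admissible of weight `w` (`mzvSpace 0 = ℚ · 1`, `ζ(∅) = 1`); Brown's
`MZV = ℚ[ζ(w) : w ∈ x₀X*x₁]` [Brown 2009, Def. 5.10] is this span (his sums
`∑_{0<k₁<⋯<k_r} k₁^{-n₁}⋯k_r^{-n_r}`, `n_r ≥ 2`, are the tree's `multipleZeta [n_r, …, n₁]`).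

Every cell `X_{S,δ'}` is carried onto the standard one by the symmetric group, and a union of cells
is a sum, so the single-cell statement is the working form of Cor 8.3; the `ℚ[2πi]` of Thm 1.1 only
enters for non-real framings. (TODO(general form): relative periods `∫_{X_B} ω_A` for arbitrary
boundary data `(A, B)` of `𝔐̄_{0,n}`, Thm 1.1 as printed, and unions of cells, Cor 8.3.)

## Why it is a named fact

Brown's proof constructs the differential algebra of generalised polylogarithms on `𝔐_{0,S}`,
proves the existence of pole-free primitives (Prop 8.1) and computes regularised restrictions to the
faces of the Stasheff polytope (Thm 6.25), then applies Stokes inductively (Thm 8.2); the reduction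
of an arbitrary convergent form to the positive dihedral monomials `∏ u_{ij}^{α_{ij}} ω_{S,δ}`,
`α ≥ 0`, is Lemma 7.4 (absolute convergence ⇔ no poles along `∂X̄_{S,δ}`). None of this
(hyperlogarithms, iterated integrals, dihedral coordinates on `𝔐̄_{0,n}`) exists in Mathlib or in
the tree; the other known proofs (Terasoma 2002 via Drinfel'd associators; Bogner–Brown 2015 /
Panzer 2015 via hyperlogarithm integration with regularised limits) are of the same size.
Term-by-term evaluation is NOT available: single monomials of a convergent integrand diverge
(e.g. `(t₀² - t₁)/(t₀² (1 - t₁)²)` is absolutely integrable on the `2`-cell while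
`t₁/(t₀² (1 - t₁)²)` is not).

What the tree does have: Kontsevich's formula `KZ.mzvRep_value_holds` (the MZV simplex integrals,
which are the case `P = 1`, `a = 0`, `b = 1 - ε`, `c = ε` of the class above, so every multiple zeta
value of weight `ℓ` does occur [Brown 2009, §7.3, the forms `Ω(ε)`]), and the genus-zero product
maps (`GenusZeroProductType*.lean`, Brown 2009 §2.7).

## Use

Summit `KontsevichZagierPeriods`, route `LinRedNormalForm`: the support item `GenusZeroValuesMzv`
(value-level shadow of the crux `DihedralNormalForm`) is this fact transported into the KZ calculus
(`Theorems/LinRedNormalFormGenusZeroValuesMzv.lean`).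
-/

noncomputable section

open MeasureTheory

namespace Literature.NumberTheory.Transcendental

/-- **Brown's theorem: the periods of the moduli spaces `𝔐_{0,n}` are multiple zeta values**
(the prediction of Goncharov–Manin, PROVED by Brown) — real single-cell form in simplicial
coordinates.
Let `ℓ ≥ 0` and let `f = P(t) / (∏ᵢ tᵢ^{bᵢ} · ∏ᵢ (1 - tᵢ)^{cᵢ} · ∏_{i<j} (tᵢ - tⱼ)^{aᵢⱼ})`,
`P ∈ ℚ[t₀, …, t_{ℓ-1}]`, i.e. `f dt₀ ∧ ⋯ ∧ dt_{ℓ-1}` an arbitrary regular `ℓ`-form on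
`𝔐_{0,ℓ+3} ≅ {t ∈ 𝔸^ℓ | tᵢ ∉ {0,1}, tᵢ ≠ tⱼ}` defined over `ℚ` [Brown 2009, §2.1]. If the
integral of `f` over the standard cell `X_{S,δ} = {1 > t₀ > ⋯ > t_{ℓ-1} > 0}`
(`KZ.openOrderedSimplex ℓ`) converges absolutely, then it is a `ℚ`-linear combination of multiple
zeta values `ζ(s₁, …, s_k)` of weight at most `ℓ`:  `∫_{X_{S,δ}} f dt ∈ ∑_{w ≤ ℓ} 𝒵_w`
(`mzvSpace w`, the `ℚ`-span of the admissible multiple zeta values of weight `w`; `𝒵₀ = ℚ`).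
[Brown, Ann. Sci. ÉNS 42 (2009): Thm 1.1 "the integral is a `ℚ[2πi]`-linear combination of
multiple zeta values of weight at most `ℓ`"; for real cells Lemma 7.4 (an absolutely convergent
cell integral of a regular form is a `ℚ`-combination of the dihedral integrals `I_{S,δ}(α)`,
`α ≥ 0`), Thm 8.2 (`I_{S,δ}(α) ∈ W^ℓ MZV`) and Cor 8.3 ("every relative period integral over a
union of cells `X_{S,δᵢ}` can be written as a linear combination of multiple zeta values of weight
at most `dim 𝔐_{0,S}(ℝ)`").] [cite: BrownENS2009, Thm 1.1 and Cor 8.3] -/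
def GenusZeroPeriodsMZV : Prop :=
  ∀ (ℓ : ℕ) (p : MvPolynomial (Fin ℓ) ℚ) (a : Fin ℓ → Fin ℓ → ℕ) (b c : Fin ℓ → ℕ),
    IntegrableOn (fun t : Fin ℓ → ℝ => MvPolynomial.aeval t p /
        ((∏ i, t i ^ b i) * (∏ i, (1 - t i) ^ c i) *
          ∏ i, ∏ j, if i < j then (t i - t j) ^ a i j else 1))
      (KZ.openOrderedSimplex ℓ) volume →
    (∫ t in KZ.openOrderedSimplex ℓ, MvPolynomial.aeval t p /
        ((∏ i, t i ^ b i) * (∏ i, (1 - t i) ^ c i) *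
          ∏ i, ∏ j, if i < j then (t i - t j) ^ a i j else 1)) ∈
      ⨆ (w : ℕ) (_ : w ≤ ℓ), mzvSpace w

-- TODO(general form): Brown 2009 Thm 1.1 / Cor 8.3 treat relative periods over unions of cells
-- `X_{S,δᵢ}` for all dihedral structures (reduced to one cell by the symmetric group) and, for
-- general framings `(A, B)` on `𝔐̄_{0,n}`, `ℚ[2πi]`-linear combinations; only the real single-cell
-- case is recorded here.

end Literature.NumberTheory.Transcendental
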